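import Literature.AnabelianGeometry.SemiGraphs.ArithVerticialCompactAmple
import Literature.AnabelianGeometry.SemiGraphs.ArithLevelData
import Literature.AnabelianGeometry.SemiGraphs.ArithLevelDataThm54
import HarnessLib

/-!
# [SemiAnbd] Rmk 5.3.1 (first sentence) over the HYPOTHESIS PACKAGES `ArithChartAction` / `ArithLevelData`

Mochizuki, *Semi-graphs of anabelioids*, Publ. RIMS **42** (2006), §5, Rmk 5.3.1 p. 65 and Def 5.1 (i)
p. 62 [cite: MochizukiSemiAnbd2006, Rmk 5.3.1 p.65].  PROOF-ONLY companion (abc-iut cell, sub-DAG Thm54,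
row T54-1 follow-up by abc-iut-w4-d029): the loose binders of `ArithVerticialCompactAmple.lean` are
instantiated BY NAME from the producer's packages (abc-iut-w4-d053, `ArithLevelData.lean`):

* `ArithChartAction.isArithAmple_arithVertGp`: for the decomposition data produced from the tempered
  chart, the verticial decomposition groups `Π^temp_{𝔊,v} = arithVertGp R ι v` are ARITHMETICALLY AMPLE —
  from the fields `conj_verticial` (Prop 3.6 (iv) at `ρ(aug g)`) and `exists_open_trivial`
  (Def 5.1 (i)(c)) plus `aug ∘ ι = 1` and `aug` surjective (Prop 5.2 (iv));
* `ArithChartAction.verticialEdgeLikeCompactAmple`: the full `VerticialEdgeLikeCompactAmpleStatement` for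
  `decompositionDataOfChart R ι` modulo the honest residual binders — the branch PAIR conjugation property
  `hconjPair` (not derivable from the edge-granular field `conj_edgeLike` when the edge is a loop) and
  compactness of the representatives `hVc`, `hBc` (LEVEL-B producer debt T54-B; cf.
  `isCompact_commensurator_of_thickening`);
* `ArithLevelData.isClosed_of_isVerticial` / `isClosed_of_isEdgeLike`: at TREE level every verticial and
  every edge-like subgroup of `D` is CLOSED in `Π^temp_𝔊` — they are common stabilisers under the level
  actions `act j`, which have open kernels (fields `fix`, `edgeFix`, `isOpen_ker`);
* `ArithLevelData.arithMaximalCompactStatementII_of_representatives`: the PACKAGED Thm 5.4 (ii)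
  (`ArithLevelDataThm54.lean`, abc-iut-w4-d053) with its input `hR` (Rmk 5.3.1) replaced by the four
  representative-level binders `hVc`/`hVa`/`hBc`/`hBa` through Layer 0.

Typed ≠ proved for the packages themselves; nothing here bears on [IUTchIII] Cor. 3.12.
-/

namespace Literature.AnabelianGeometry.SemiGraphs

open CategoryTheory Topology

universe v u u' u''

namespace ProfiniteSemiGraph

variable {𝒢 : ProfiniteSemiGraph.{u}} {c : TemperedPiChart 𝒢} {Gtp : Type u'} [Group Gtp]
  {PA : Type u''} [Group PA] [TopologicalSpace PA] [IsTopologicalGroup PA]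
  {ι : c.G →* Gtp} {aug : Gtp →* PA}
  {actV : PA → 𝒢.graph.Vertex → 𝒢.graph.Vertex} {actE : PA → 𝒢.graph.Edge → 𝒢.graph.Edge}
  {actB : PA → 𝒢.graph.Branch → 𝒢.graph.Branch}

/-- **[SemiAnbd] Rmk 5.3.1 for vertices, over the package `ArithChartAction`**: the verticial
decomposition groups of the produced data are arithmetically ample.
[cite: MochizukiSemiAnbd2006, Rmk 5.3.1 p.65] -/
theorem ArithChartAction.isArithAmple_arithVertGp (A : ArithChartAction c ι aug actV actE actB)
    (R : ChartRepresentatives c) (hιaug : ∀ h : c.G, aug (ι h) = 1) (hsurj : Function.Surjective aug)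
    (v : 𝒢.graph.Vertex) : IsArithAmple aug (arithVertGp R ι v) := by
  refine ProfiniteSemiGraph.isArithAmple_arithVertGp R ι aug actV hιaug hsurj A.conj_verticial ?_ v
  obtain ⟨U, hU, htriv⟩ := A.exists_open_trivial
  exact ⟨U, hU, fun a ha w => (htriv a ha).1 w⟩

/-- **[SemiAnbd] Rmk 5.3.1, first sentence, over the package `ArithChartAction`** for the produced data
of a GRAPH of anabelioids (`hG`: every branch abuts), modulo the residual binders `hconjPair` (branch pair
conjugation) and `hVc`, `hBc` (compactness of the representatives, producer debt T54-B).
[cite: MochizukiSemiAnbd2006, Rmk 5.3.1 p.65] -/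
theorem ArithChartAction.verticialEdgeLikeCompactAmple [TopologicalSpace Gtp] [IsTopologicalGroup Gtp]
    (A : ArithChartAction c ι aug actV actE actB) (R : ChartRepresentatives c)
    (hιaug : ∀ h : c.G, aug (ι h) = 1) (hsurj : Function.Surjective aug) (hG : 𝒢.graph.IsGraph)
    (hconjPair : ∀ (b : 𝒢.graph.Branch) (v : 𝒢.graph.Vertex), 𝒢.graph.abuts b = some v →
      ∃ U : Subgroup PA, IsOpen (U : Set PA) ∧ ∀ a ∈ U, ∃ g : Gtp, aug g = a ∧ ∃ h : c.G,
        conjSubgroup g ((R.Hv v).map ι) = conjSubgroup (ι h) ((R.Hv v).map ι) ∧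
          conjSubgroup g ((R.Hb b).map ι) = conjSubgroup (ι h) ((R.Hb b).map ι))
    (hVc : ∀ v, IsCompact (arithVertGp R ι v : Set Gtp))
    (hBc : ∀ b, IsCompact (arithBrGp R ι b : Set Gtp)) :
    VerticialEdgeLikeCompactAmpleStatement (decompositionDataOfChart R ι) aug := by
  refine verticialEdgeLikeCompactAmple_decompositionDataOfChart R ι aug actV hιaug hsurj
    A.conj_verticial ?_ (abut_isSome_of_isGraph R ι hG) hconjPair hVc hBc
  obtain ⟨U, hU, htriv⟩ := A.exists_open_trivial
  exact ⟨U, hU, fun a ha w => (htriv a ha).1 w⟩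

end ProfiniteSemiGraph

namespace ArithLevelData

variable {Gtp : Type u'} [Group Gtp] [TopologicalSpace Gtp] [IsTopologicalGroup Gtp]
  {PA : Type u''} [Group PA] {𝔾 : SemiGraph.{u}} {D : DecompositionData Gtp 𝔾.Vertex 𝔾.Branch}
  {aug : Gtp →* PA} {baseAct : PA →* Aut 𝔾}

/-- **At tree level every verticial subgroup is closed**: by the dictionary field `fix` it is the common
stabiliser of a compatible system of tree vertices under the open-kernel actions `act j`.
[cite: MochizukiSemiAnbd2006, Thm 5.4 (i), p. 66] -/
theorem isClosed_of_isVerticial (L : ArithLevelData.{v} 𝔾 D aug baseAct) (W : Subgroup Gtp)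
    (hW : IsVerticial D W) : IsClosed (W : Set Gtp) := by
  obtain ⟨x, -, hx⟩ := L.fix W hW
  exact isClosed_of_mem_iff_forall_apply L.act L.isOpen_ker
    (fun j (φ : Aut (L.tree j)) => φ.hom.vertexMap (x j) = x j) W hx

/-- **At tree level every edge-like subgroup is closed**: by the dictionary field `edgeFix` it is the
common stabiliser of an eventual compatible system of tree edges with their branches.
[cite: MochizukiSemiAnbd2006, Thm 5.4 (i), p. 66] -/
theorem isClosed_of_isEdgeLike (L : ArithLevelData.{v} 𝔾 D aug baseAct) (K : Subgroup Gtp)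
    (hK : IsEdgeLike D K) : IsClosed (K : Set Gtp) := by
  obtain ⟨i, ε, -, -, -, -, -, -, -, hK⟩ := L.edgeFix K hK
  exact isClosed_of_mem_iff_forall_apply (fun j : {j : L.J // i ≤ j} => L.act j.1)
    (fun j => L.isOpen_ker j.1)
    (fun j (φ : Aut (L.tree j.1)) => φ.hom.edgeMap (ε j) = ε j ∧
      ∀ b : (L.tree j.1).Branch, (L.tree j.1).edgeOf b = ε j → φ.hom.branchMap b = b) K hK

end ArithLevelData

namespace ArithLevelData

-- the packaged assembly lives at `Gtp : Type u`, `𝔾 : SemiGraph.{u}` (one universe, as upstream)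
variable {Gtp : Type u} [Group Gtp] [TopologicalSpace Gtp] [IsTopologicalGroup Gtp] [T2Space Gtp]
  {PA : Type u''} [Group PA] [TopologicalSpace PA] [IsTopologicalGroup PA]
  {𝔾 : SemiGraph.{u}} {D : DecompositionData Gtp 𝔾.Vertex 𝔾.Branch} {aug : Gtp →* PA}
  {baseAct : PA →* Aut 𝔾}

/-- **[SemiAnbd] Thm 5.4 (ii) over the package, Rmk 5.3.1 fed at representative level**: the packaged
assembly `ArithLevelData.arithMaximalCompactStatementII_of` with `hR` discharged by Layer 0 from
compactness and arithmetic ampleness of the chosen representatives `D.vertGp v`, `D.brGp b` only.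
[cite: MochizukiSemiAnbd2006, Thm 5.4 (ii), p. 66] -/
theorem arithMaximalCompactStatementII_of_representatives (L : ArithLevelData.{v} 𝔾 D aug baseAct)
    (habuts : ∀ b : 𝔾.Branch, ∃ v : 𝔾.Vertex, D.abut b = some v)
    (hest : IsTotallyArithEstranged D aug) (hbot : ¬ IsArithAmple aug ⊥)
    (hVc : ∀ v, IsCompact (D.vertGp v : Set Gtp)) (hVa : ∀ v, IsArithAmple aug (D.vertGp v))
    (hBc : ∀ b, IsCompact (D.brGp b : Set Gtp)) (hBa : ∀ b, IsArithAmple aug (D.brGp b))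
    (hVE : ∀ K : Subgroup Gtp, IsVerticial D K → ¬ IsEdgeLike D K) :
    ArithMaximalCompactStatementII D aug :=
  L.arithMaximalCompactStatementII_of habuts hest hbot
    (verticialEdgeLikeCompactAmple_of_representatives D aug hVc hVa hBc hBa) hVE

end ArithLevelData

end Literature.AnabelianGeometry.SemiGraphs
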